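import Mathlib
import HarnessLib
import Literature.MathematicalPhysics.QuantumLattice.GrassmannWeightedEffectiveActionTruncationDB
import Literature.MathematicalPhysics.QuantumLattice.SectorisedIncrementBoundBinomialWeightedPlateau
import Summits.HubbardSuperconductivity.HubbardSuperconductivity.Theorems.KLProgrammeKLRegimeTwoVolumeLipDoubledTruncDefs

/-!
# Route `KLProgramme` — crux K3 ENGINE (stmt-HubbardSuperconductivity-20437), stub (e) proof-input «(e)-D-ROWS», keying (A′), REKEY-D item «DOUBLED-STEP-SOURCES»:
# THE ONE-VOLUME STEP-SOURCE ROWS `hNs / hNfar` (and `hNI / hNIfar`) OF THE SOURCE-TRUNCATED DOUBLED ASSEMBLY, FROM THE N4⁺ INPUT PROFILES AND THE SECTOR COVARIANCE DATA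
# (seat hubbard-kl-k3c4-p1 g30; pen (R569) standing word; `--supports` 23356)

The truncated-doubled assembly ✓ `…TwoVolumeLipDoubledTruncLawOfRowsBase1Boot.klLipBornDiffSupDT_le_law_of_rows_base1_boot` asks, per block `k` and degree `2p`, the RAW
pinned rows `hNs` and the FAR rows `hNfar` (strings with a leg at spatial torus distance `> r` from the pin) of the coarse one-volume Born remainder of the TRUNCATED
doubled input, `effAction (klLipCovD L … d k) (klLipInputDT L … d k) − klLipInputDT L … d k` — ALL its strings, including those with `≥ 3` plain legs, which are not
objects of E1's source-graded tower.  They close from the N4⁺-class WEIGHTED input profile of `klLipInputDT` (✓ DT0 `sum_wt_norm_kernel_klLipInputDT_le`: `≤ ε·klLipInputMeasDT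
… j_w`) and the coarse block covariance's sector data (Gram constant `κ` of `klLipCov L … d k`, `klScaleWt`-weighted rows/columns `≤ α` at the rate `j_w`) by ONE weighted
one-volume step at the spectator covariance `C ⊕ 0`:

* §1 weighted profile ⇒ rows: `one_add_klScale_mul_le_klLabelWt_of_far` (a far string's position set has `klScaleWt ≥ 1 + Λ_{j_w}(r+1)`), **`sum_norm_kernel_le_of_wt_profile`**
  (raw row `≤` weighted profile), **`sum_far_norm_kernel_le_of_wt_profile`** (far row `≤` weighted profile `/ (1 + Λ_{j_w}(r+1))`);
* §2 **`truncStepSource_wt_profile_le`** — the `klScaleWt_{j_w}`-weighted pinned profile of the Born remainder in degree `2p`, `p ≥ 1`: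
  `≤ Σ_{m' ≤ |Γ|/2, p < m'} C(2m',2p) κ^{2m'−2p} N(m') + ρ^{−2p}·e‖N‖_h·θ/(1−θ)`, `θ = eα‖N‖_h/κ² < 1`, for any majorant `N(m') ≥ ε·klLipInputMeasDT … j_w (2m')`
  (first order = `Lit/SectorisedIncrementBoundBinomialWeightedPlateau.sum_wt_norm_kernel_gaussConv_sub_le_binomial_of_gramBounded_wt`; orders `≥ 2` =
  `Lit/GrassmannWeightedEffectiveActionTruncationDB.sum_wt_norm_kernel_effAction_sub_gaussConv_le_of_gramBounded`; data of `C ⊕ 0` = ✓ D2a `isGramBoundedR_klLipCovD`,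
  `rowSum_/colSum_spectator_wt_le`; parity / constant part = ✓ DT0 + `klEffectiveAction_mem_evenOdd_zero` / `constPart_klEffectiveAction_eq_zero` under the token `Z ≠ 0`);
  `truncStepSource_bound_nonneg`; **`truncStepSource_raw_row_le`**, **`truncStepSource_far_row_le`** (the `hNs` / `hNfar` shapes, degree written `(2p−1)+1`);
* §3 **`truncStepSources_rows_of_majorants`** — the PAIR `(hNs, hNfar)` of the assembly verbatim (`∀ k < K_b, ∀ p ≤ D, …`) for any arrays `Ns, Nfar` dominating the §2 bound
  resp. the §2 bound `/ (1 + Λ_{j_w}(r+1))`; **`truncInput_raw_row_le`**, **`truncInput_far_row_le`** (the `hNI` / `hNIfar` rows of `klLipInputDT … d 1`, same mechanism).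

Compositions of landed theorems; every profile / row / token is a hypothesis; nothing about the model is asserted beyond them; nothing asserts the (D) rows, stub (e), VL,
K3 or superconductivity.  References: BGM 2006 §2.8 (2.61)–(2.66), (2.77)–(2.90), §3 (3.2)–(3.8) [cite: BenfattoGiulianiMastropietro2006]; Gawȩdzki–Kupiainen 1985 §3.
-/

noncomputable section

namespace Summit.HubbardSuperconductivity.HubbardSuperconductivity.Theorems.TwoVolumeLip

set_option linter.dupNamespace false -- summit = problem name (single-conjunct summit), D-0017

open Finset Literature.MathematicalPhysics.QuantumLattice GrassmannAlgebra Literature.Probability.LatticeModels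
  Literature.Probability.LatticeModels.BattleFederbush
open Literature.MathematicalPhysics.QuantumLattice.FermiRG
open Summit.HubbardSuperconductivity.HubbardSuperconductivity.Theorems.KLRegimeSplit
open Summit.HubbardSuperconductivity.HubbardSuperconductivity.Theorems.KLProgrammeLegKernels
open Summit.HubbardSuperconductivity.HubbardSuperconductivity.Theorems.EngineV8
open Summit.HubbardSuperconductivity.HubbardSuperconductivity.Theorems.TwoVolumeSource
open Summit.HubbardSuperconductivity.HubbardSuperconductivity.Theorems.TwoVolumeDefect

/-! ## §1 From a `klScaleWt`-weighted pinned profile to the raw row and the far row -/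

section FarRows

variable {V M : ℕ} [NeZero V] {n : ℕ}

/-- **A far string carries weight**: if legs `q` and `i` of the string `Y` sit at spatial torus distance `> r`, then the scale-`j_w` tree weight of its position set is at
least `1 + Λ_{j_w}·(r+1)` (`Torus.tnorm = torusSiteDist ≤ gridLabelDist ≤ labelDiam`; `0 ≤ β`). -/
theorem one_add_klScale_mul_le_klLabelWt_of_far {β : ℝ} (hβ : 0 ≤ β) (jw : ℕ) {m : ℕ} (Y : Fin m → SrcLabel V M n) (q i : Fin m) {r : ℕ}
    (hfar : r < Torus.tnorm ((Y q).1.1.2 - (Y i).1.1.2)) :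
    1 + klScale klE0 jw * ((r : ℝ) + 1) ≤ klLabelWt (klScaleWt V M β jw) ((univ.image Y).image Prod.fst) := by
  rw [klLabelWt_apply, klScaleWt_apply]
  have hΛ : 0 ≤ klScale klE0 jw := (klth_klScale_pos jw).le
  have hmem : ∀ j, latticeLegPos (2 * (2 * M)) (Y j).1 ∈ ((univ.image Y).image Prod.fst).image (latticeLegPos (2 * (2 * M))) :=
    fun j => mem_image_of_mem _ (mem_image_of_mem _ (mem_image_of_mem _ (mem_univ j)))
  have hd : (r : ℝ) + 1 ≤ labelDiam (gridLabelDist V (2 * (2 * M)) β) (((univ.image Y).image Prod.fst).image (latticeLegPos (2 * (2 * M)))) := by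
    have h1 : (r : ℝ) + 1 ≤ (Torus.tnorm ((Y q).1.1.2 - (Y i).1.1.2) : ℝ) := by exact_mod_cast Nat.succ_le_of_lt hfar
    rw [tnorm_sub_eq_torusSiteDist] at h1
    exact (h1.trans (torusSiteDist_le_gridLabelDist hβ (latticeLegPos (2 * (2 * M)) (Y q).1) (latticeLegPos (2 * (2 * M)) (Y i).1))).trans
      (le_labelDiam _ (hmem q) (hmem i))
  have := mul_le_mul_of_nonneg_left hd hΛ
  linarith

/-- **Raw row from a weighted profile**: the weight is `≥ 1`, so the unweighted pinned sum is at most any bound of the weighted one. -/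
theorem sum_norm_kernel_le_of_wt_profile (β : ℝ) (jw : ℕ) {m : ℕ} (F : GrassmannAlgebra ℂ (SrcLabel V M n)) (q : Fin m) (y : SrcLabel V M n) {B : ℝ}
    (hB : ∑ Y ∈ univ.filter (fun Y : Fin m → SrcLabel V M n => Y q = y),
      ‖kernel ℂ F m Y‖ * klLabelWt (klScaleWt V M β jw) ((univ.image Y).image Prod.fst) ≤ B) :
    ∑ Y ∈ univ.filter (fun Y : Fin m → SrcLabel V M n => Y q = y), ‖kernel ℂ F m Y‖ ≤ B :=
  (sum_le_sum fun _ _ => le_mul_of_one_le_right (norm_nonneg _) (one_le_klScaleWt V M β jw _)).trans hB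

/-- **Far row from a weighted profile**: the pinned sum over the strings whose leg `i` is at spatial torus distance `> r` from the pin `q` is at most the weighted
profile bound divided by `1 + Λ_{j_w}·(r+1)` (`0 ≤ β`). -/
theorem sum_far_norm_kernel_le_of_wt_profile {β : ℝ} (hβ : 0 ≤ β) (jw : ℕ) {m : ℕ} (F : GrassmannAlgebra ℂ (SrcLabel V M n)) (q i : Fin m)
    (y : SrcLabel V M n) (r : ℕ) {B : ℝ}
    (hB : ∑ Y ∈ univ.filter (fun Y : Fin m → SrcLabel V M n => Y q = y),
      ‖kernel ℂ F m Y‖ * klLabelWt (klScaleWt V M β jw) ((univ.image Y).image Prod.fst) ≤ B) :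
    ∑ Y ∈ univ.filter (fun Y : Fin m → SrcLabel V M n => Y q = y ∧ r < Torus.tnorm ((Y q).1.1.2 - (Y i).1.1.2)), ‖kernel ℂ F m Y‖ ≤
      B / (1 + klScale klE0 jw * ((r : ℝ) + 1)) := by
  have hc : 0 < 1 + klScale klE0 jw * ((r : ℝ) + 1) := by have := (klth_klScale_pos jw).le; positivity
  rw [le_div_iff₀ hc, sum_mul]
  calc ∑ Y ∈ univ.filter (fun Y : Fin m → SrcLabel V M n => Y q = y ∧ r < Torus.tnorm ((Y q).1.1.2 - (Y i).1.1.2)),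
        ‖kernel ℂ F m Y‖ * (1 + klScale klE0 jw * ((r : ℝ) + 1))
      ≤ ∑ Y ∈ univ.filter (fun Y : Fin m → SrcLabel V M n => Y q = y ∧ r < Torus.tnorm ((Y q).1.1.2 - (Y i).1.1.2)),
        ‖kernel ℂ F m Y‖ * klLabelWt (klScaleWt V M β jw) ((univ.image Y).image Prod.fst) :=
        sum_le_sum fun Y hY => mul_le_mul_of_nonneg_left (one_add_klScale_mul_le_klLabelWt_of_far hβ jw Y q i (mem_filter.1 hY).2.2) (norm_nonneg _)
    _ ≤ ∑ Y ∈ univ.filter (fun Y : Fin m → SrcLabel V M n => Y q = y), ‖kernel ℂ F m Y‖ * klLabelWt (klScaleWt V M β jw) ((univ.image Y).image Prod.fst) :=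
        sum_le_sum_of_subset_of_nonneg (fun Y hY => mem_filter.2 ⟨mem_univ _, (mem_filter.1 hY).2.1⟩)
          fun Y _ _ => mul_nonneg (norm_nonneg _) (zero_le_one.trans (one_le_klScaleWt V M β jw _))
    _ ≤ B := hB

end FarRows

/-! ## §2 The weighted Born-remainder profile of the truncated doubled input at one volume, and its raw / far rows -/

section StepSource

variable {V M : ℕ} [NeZero V] [NeZero M]

set_option maxHeartbeats 800000 in -- two long door instantiations
/-- **THE WEIGHTED ONE-VOLUME STEP-SOURCE PROFILE OF THE TRUNCATED DOUBLED INPUT** (volume `V`, block `k`, frame `K`, token `Z^K_{V,Λ_{dk}} ≠ 0`, rate `j_w`).  With `C := klLipCov V … d k`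
replica-Gram-bounded by `κ`, its `klScaleWt_{j_w}`-weighted rows / columns `≤ α`, a majorant `N(m') ≥ ε·klLipInputMeasDT V … d k j_w (2m')` of the weighted input profile, `ρ > 0` and
`θ := eα‖N‖_h/κ² < 1` (`‖N‖_h = normV`): for every `p ≥ 1`, slot `q`, pin `y`, the `klScaleWt_{j_w}`-weighted pinned sum in degree `(2p−1)+1` of the Born remainder
`effAction (C ⊕ 0) (klLipInputDT V … d k) − klLipInputDT V … d k` is at most `Σ_{m' ≤ |Γ|/2, p < m'} C(2m',2p) κ^{2m'−2p} N(m') + ρ^{−2p}·e‖N‖_h·θ/(1−θ)` (first order: binomial–Gram;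
orders `≥ 2`: the weighted determinant-bounded step). [cite: BenfattoGiulianiMastropietro2006, §2.8 (2.61)-(2.66), (2.86)-(2.90), §3 (3.2)-(3.8)] -/
theorem truncStepSource_wt_profile_le {β : ℝ} (hβ : 0 < β) (U μ : ℝ) (K : TrigPolyC4v) (d k jw : ℕ)
    (hZ : hubbardEffPartitionFnCT V M β U μ 0 K (klScale klE0 (d * k)) ≠ 0)
    {κ : ℝ} (hκ : 0 < κ) (hGB : IsGramBoundedR (klLipCov V M β μ K d k) κ)
    (N : ℕ → ℝ) (hN0 : ∀ m', 0 ≤ N m') (hN : ∀ m', imagTimeWeight β M * klLipInputMeasDT V M β U μ K d k jw (2 * m') ≤ N m')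
    {α : ℝ} (hα : 0 < α)
    (hrow : ∀ X, ∑ Y, ‖klLipCov V M β μ K d k X Y‖ * klScaleWt V M β jw {latticeLegPos (2 * (2 * M)) X, latticeLegPos (2 * (2 * M)) Y} ≤ α)
    (hcol : ∀ Y, ∑ X, ‖klLipCov V M β μ K d k X Y‖ * klScaleWt V M β jw {latticeLegPos (2 * (2 * M)) X, latticeLegPos (2 * (2 * M)) Y} ≤ α)
    {ρ : ℝ} (hρ : 0 < ρ) (hθ : Real.exp 1 * α * normV (SrcLabel V M (d * k - 1)) κ ρ N / κ ^ 2 < 1)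
    {p : ℕ} (hp : 1 ≤ p) (q : Fin ((2 * p - 1) + 1)) (y : SrcLabel V M (d * k - 1)) :
    ∑ Y ∈ univ.filter (fun Y : Fin ((2 * p - 1) + 1) → SrcLabel V M (d * k - 1) => Y q = y),
        ‖kernel ℂ (effAction ℂ (klLipCovD V M β μ K d k) (klLipInputDT V M β U μ K d k) - klLipInputDT V M β U μ K d k) ((2 * p - 1) + 1) Y‖ *
          klLabelWt (klScaleWt V M β jw) ((univ.image Y).image Prod.fst) ≤
      (∑ m' ∈ range (Fintype.card (SrcLabel V M (d * k - 1)) / 2 + 1),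
          if p < m' then ((2 * m').choose (2 * p) : ℝ) * κ ^ (2 * m' - 2 * p) * N m' else 0) +
        ρ⁻¹ ^ (2 * p) * (Real.exp 1 * normV (SrcLabel V M (d * k - 1)) κ ρ N) *
          (Real.exp 1 * α * normV (SrcLabel V M (d * k - 1)) κ ρ N / κ ^ 2) / (1 - Real.exp 1 * α * normV (SrcLabel V M (d * k - 1)) κ ρ N / κ ^ 2) := by
  classical
  -- names
  set C := klLipCovD V M β μ K d k with hC
  set W := klLipInputDT V M β U μ K d k with hW
  set wt : Finset (SrcLabel V M (d * k - 1)) → ℝ := fun S => klLabelWt (klScaleWt V M β jw) (S.image Prod.fst) with hwt_def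
  have hwt : IsTreeWeight wt := (isTreeWeight_klLabelWt_klScaleWt (N := sectorCount (d * k - 1)) hβ.le jw).comap Prod.fst
  -- parity, constant part, Gram datum of `C ⊕ 0`
  have hIe : klTowerInput V M β U μ K d k ∈ evenOdd ℂ 0 :=
    Summit.HubbardSuperconductivity.HubbardSuperconductivity.Theorems.KLRegimeWick.klEffectiveAction_mem_evenOdd_zero β U μ K klE0 (d * k)
  have hWe : W ∈ evenPart ℂ (SrcLabel V M (d * k - 1)) := klLipInputDT_mem_evenOdd_zero hIe
  have hW0 : constPart ℂ W = 0 := constPart_klLipInputDT (constPart_klEffectiveAction_eq_zero β U μ K klE0 (d * k) hZ)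
  have hGBD : IsGramBoundedR C κ := isGramBoundedR_klLipCovD hGB
  -- the weighted input profile (N4⁺ currency)
  have hNW : ∀ (m' : ℕ) (j : Fin (2 * m')) (w : SrcLabel V M (d * k - 1)),
      ∑ Y ∈ univ.filter (fun Y : Fin (2 * m') → SrcLabel V M (d * k - 1) => Y j = w), ‖kernel ℂ W (2 * m') Y‖ * wt (univ.image Y) ≤ N m' :=
    fun m' j w => (sum_wt_norm_kernel_klLipInputDT_le hβ.le U μ K d k jw j w).trans (hN m')
  -- weighted rows / columns of `C ⊕ 0`
  have hpair : ∀ X Y : SpaceTimeIdx V M × SectorLeg (sectorCount (d * k - 1)),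
      klLabelWt (klScaleWt V M β jw) {X, Y} = klScaleWt V M β jw {latticeLegPos (2 * (2 * M)) X, latticeLegPos (2 * (2 * M)) Y} := by
    intro X Y
    rw [klLabelWt_apply, image_insert, image_singleton]
  have hrow' : ∀ X, ∑ Y, ‖klLipCov V M β μ K d k X Y‖ * klLabelWt (klScaleWt V M β jw) {X, Y} ≤ α := fun X => by
    simpa only [hpair] using hrow X
  have hcol' : ∀ Y, ∑ X, ‖klLipCov V M β μ K d k X Y‖ * klLabelWt (klScaleWt V M β jw) {X, Y} ≤ α := fun Y => by
    simpa only [hpair] using hcol Y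
  have hrowD : ∀ X, ∑ Y, ‖C X Y‖ * wt {X, Y} ≤ α := fun X =>
    rowSum_spectator_wt_le _ _ hα.le hrow' _ (klLipCovD_apply β μ K d k) X
  have hcolD : ∀ Y, ∑ X, ‖C X Y‖ * wt {X, Y} ≤ α := fun Y =>
    colSum_spectator_wt_le _ _ hα.le hcol' _ (klLipCovD_apply β μ K d k) Y
  -- kernels of the remainder split into orders `≥ 2` and first order
  have hsplit : ∀ {m : ℕ} (Y : Fin m → SrcLabel V M (d * k - 1)), kernel ℂ (effAction ℂ C W - W) m Y =
      kernel ℂ (effAction ℂ C W - gaussConv ℂ C W) m Y + kernel ℂ (gaussConv ℂ C W - W) m Y := by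
    intro m Y
    rw [← kernel_add, sub_add_sub_cancel]
  -- the degree `(2p−1)+1 = 2p`, generalised
  have hgen : ∀ (m : ℕ), m = 2 * p → ∀ (q : Fin m) (y : SrcLabel V M (d * k - 1)),
      ∑ Y ∈ univ.filter (fun Y : Fin m → SrcLabel V M (d * k - 1) => Y q = y), ‖kernel ℂ (effAction ℂ C W - W) m Y‖ * wt (univ.image Y) ≤
        (∑ m' ∈ range (Fintype.card (SrcLabel V M (d * k - 1)) / 2 + 1),
            if p < m' then ((2 * m').choose (2 * p) : ℝ) * κ ^ (2 * m' - 2 * p) * N m' else 0) +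
          ρ⁻¹ ^ (2 * p) * (Real.exp 1 * normV (SrcLabel V M (d * k - 1)) κ ρ N) *
            (Real.exp 1 * α * normV (SrcLabel V M (d * k - 1)) κ ρ N / κ ^ 2) /
              (1 - Real.exp 1 * α * normV (SrcLabel V M (d * k - 1)) κ ρ N / κ ^ 2) := by
    rintro m rfl q y
    have h2 := (sum_wt_norm_kernel_effAction_sub_gaussConv_le_of_gramBounded C hwt hκ hGBD W hWe hW0 N hN0 hNW hα hrowD hcolD hρ hθ).2
      (show 0 < 2 * p by omega) q y
    have h1 := sum_wt_norm_kernel_gaussConv_sub_le_binomial_of_gramBounded_wt C hwt hκ.le hGBD W hWe N hN0 hNW q y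
    calc ∑ Y ∈ univ.filter (fun Y : Fin (2 * p) → SrcLabel V M (d * k - 1) => Y q = y), ‖kernel ℂ (effAction ℂ C W - W) (2 * p) Y‖ * wt (univ.image Y)
        ≤ ∑ Y ∈ univ.filter (fun Y : Fin (2 * p) → SrcLabel V M (d * k - 1) => Y q = y),
            (wt (univ.image Y) * ‖kernel ℂ (effAction ℂ C W - gaussConv ℂ C W) (2 * p) Y‖ +
              wt (univ.image Y) * ‖kernel ℂ (gaussConv ℂ C W - W) (2 * p) Y‖) :=
          sum_le_sum fun Y _ => by
            rw [hsplit, mul_comm, ← mul_add]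
            exact mul_le_mul_of_nonneg_left (norm_add_le _ _) (hwt.nonneg _)
      _ = (∑ Y ∈ univ.filter (fun Y : Fin (2 * p) → SrcLabel V M (d * k - 1) => Y q = y),
              wt (univ.image Y) * ‖kernel ℂ (effAction ℂ C W - gaussConv ℂ C W) (2 * p) Y‖) +
            ∑ Y ∈ univ.filter (fun Y : Fin (2 * p) → SrcLabel V M (d * k - 1) => Y q = y),
              wt (univ.image Y) * ‖kernel ℂ (gaussConv ℂ C W - W) (2 * p) Y‖ := sum_add_distrib
      _ ≤ _ := by rw [add_comm]; exact add_le_add h1 h2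
  exact hgen _ (by omega) q y

/-- The §2 bound is nonnegative (`θ < 1`, `N ≥ 0`, `κ, ρ > 0`, `α > 0`). -/
theorem truncStepSource_bound_nonneg (Γcard : ℕ) {κ α ρ : ℝ} (hκ : 0 < κ) (hα : 0 < α) (hρ : 0 < ρ) {nV : ℝ} (hnV : 0 ≤ nV)
    (hθ : Real.exp 1 * α * nV / κ ^ 2 < 1) (N : ℕ → ℝ) (hN0 : ∀ m', 0 ≤ N m') (p : ℕ) :
    0 ≤ (∑ m' ∈ range (Γcard / 2 + 1), if p < m' then ((2 * m').choose (2 * p) : ℝ) * κ ^ (2 * m' - 2 * p) * N m' else 0) +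
        ρ⁻¹ ^ (2 * p) * (Real.exp 1 * nV) * (Real.exp 1 * α * nV / κ ^ 2) / (1 - Real.exp 1 * α * nV / κ ^ 2) := by
  have h1 : 0 ≤ ∑ m' ∈ range (Γcard / 2 + 1), (if p < m' then ((2 * m').choose (2 * p) : ℝ) * κ ^ (2 * m' - 2 * p) * N m' else 0) :=
    sum_nonneg fun m' _ => by
      split_ifs
      · exact mul_nonneg (mul_nonneg (Nat.cast_nonneg _) (pow_nonneg hκ.le _)) (hN0 m')
      · exact le_rfl
  have h2 : 0 ≤ ρ⁻¹ ^ (2 * p) * (Real.exp 1 * nV) * (Real.exp 1 * α * nV / κ ^ 2) / (1 - Real.exp 1 * α * nV / κ ^ 2) :=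
    div_nonneg (by positivity) (sub_nonneg.2 hθ.le)
  exact add_nonneg h1 h2

/-- **The RAW step-source row** (the shape of the assembly's `hNs` at block `k`, degree `(2p−1)+1`): the unweighted pinned sum of the Born remainder of the truncated
doubled input is at most the §2 bound. -/
theorem truncStepSource_raw_row_le {β : ℝ} (hβ : 0 < β) (U μ : ℝ) (K : TrigPolyC4v) (d k jw : ℕ)
    (hZ : hubbardEffPartitionFnCT V M β U μ 0 K (klScale klE0 (d * k)) ≠ 0)
    {κ : ℝ} (hκ : 0 < κ) (hGB : IsGramBoundedR (klLipCov V M β μ K d k) κ)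
    (N : ℕ → ℝ) (hN0 : ∀ m', 0 ≤ N m') (hN : ∀ m', imagTimeWeight β M * klLipInputMeasDT V M β U μ K d k jw (2 * m') ≤ N m')
    {α : ℝ} (hα : 0 < α)
    (hrow : ∀ X, ∑ Y, ‖klLipCov V M β μ K d k X Y‖ * klScaleWt V M β jw {latticeLegPos (2 * (2 * M)) X, latticeLegPos (2 * (2 * M)) Y} ≤ α)
    (hcol : ∀ Y, ∑ X, ‖klLipCov V M β μ K d k X Y‖ * klScaleWt V M β jw {latticeLegPos (2 * (2 * M)) X, latticeLegPos (2 * (2 * M)) Y} ≤ α)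
    {ρ : ℝ} (hρ : 0 < ρ) (hθ : Real.exp 1 * α * normV (SrcLabel V M (d * k - 1)) κ ρ N / κ ^ 2 < 1)
    {p : ℕ} (hp : 1 ≤ p) (q : Fin ((2 * p - 1) + 1)) (y : SrcLabel V M (d * k - 1)) :
    ∑ Y ∈ univ.filter (fun Y : Fin ((2 * p - 1) + 1) → SrcLabel V M (d * k - 1) => Y q = y),
        ‖kernel ℂ (effAction ℂ (klLipCovD V M β μ K d k) (klLipInputDT V M β U μ K d k) - klLipInputDT V M β U μ K d k) ((2 * p - 1) + 1) Y‖ ≤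
      (∑ m' ∈ range (Fintype.card (SrcLabel V M (d * k - 1)) / 2 + 1),
          if p < m' then ((2 * m').choose (2 * p) : ℝ) * κ ^ (2 * m' - 2 * p) * N m' else 0) +
        ρ⁻¹ ^ (2 * p) * (Real.exp 1 * normV (SrcLabel V M (d * k - 1)) κ ρ N) *
          (Real.exp 1 * α * normV (SrcLabel V M (d * k - 1)) κ ρ N / κ ^ 2) / (1 - Real.exp 1 * α * normV (SrcLabel V M (d * k - 1)) κ ρ N / κ ^ 2) :=
  sum_norm_kernel_le_of_wt_profile β jw _ q y (truncStepSource_wt_profile_le hβ U μ K d k jw hZ hκ hGB N hN0 hN hα hrow hcol hρ hθ hp q y)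

/-- **The FAR step-source row** (the shape of the assembly's `hNfar` at block `k`, degree `(2p−1)+1`, depth `r`): the pinned sum over the strings whose leg `i` is at spatial
torus distance `> r` from the pin is at most the §2 bound divided by `1 + Λ_{j_w}·(r+1)`. -/
theorem truncStepSource_far_row_le {β : ℝ} (hβ : 0 < β) (U μ : ℝ) (K : TrigPolyC4v) (d k jw : ℕ)
    (hZ : hubbardEffPartitionFnCT V M β U μ 0 K (klScale klE0 (d * k)) ≠ 0)
    {κ : ℝ} (hκ : 0 < κ) (hGB : IsGramBoundedR (klLipCov V M β μ K d k) κ)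
    (N : ℕ → ℝ) (hN0 : ∀ m', 0 ≤ N m') (hN : ∀ m', imagTimeWeight β M * klLipInputMeasDT V M β U μ K d k jw (2 * m') ≤ N m')
    {α : ℝ} (hα : 0 < α)
    (hrow : ∀ X, ∑ Y, ‖klLipCov V M β μ K d k X Y‖ * klScaleWt V M β jw {latticeLegPos (2 * (2 * M)) X, latticeLegPos (2 * (2 * M)) Y} ≤ α)
    (hcol : ∀ Y, ∑ X, ‖klLipCov V M β μ K d k X Y‖ * klScaleWt V M β jw {latticeLegPos (2 * (2 * M)) X, latticeLegPos (2 * (2 * M)) Y} ≤ α)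
    {ρ : ℝ} (hρ : 0 < ρ) (hθ : Real.exp 1 * α * normV (SrcLabel V M (d * k - 1)) κ ρ N / κ ^ 2 < 1)
    {p : ℕ} (hp : 1 ≤ p) (q : Fin ((2 * p - 1) + 1)) (y : SrcLabel V M (d * k - 1)) (i : Fin ((2 * p - 1) + 1)) (r : ℕ) :
    ∑ Y ∈ univ.filter (fun Y : Fin ((2 * p - 1) + 1) → SrcLabel V M (d * k - 1) => Y q = y ∧ r < Torus.tnorm ((Y q).1.1.2 - (Y i).1.1.2)),
        ‖kernel ℂ (effAction ℂ (klLipCovD V M β μ K d k) (klLipInputDT V M β U μ K d k) - klLipInputDT V M β U μ K d k) ((2 * p - 1) + 1) Y‖ ≤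
      ((∑ m' ∈ range (Fintype.card (SrcLabel V M (d * k - 1)) / 2 + 1),
          if p < m' then ((2 * m').choose (2 * p) : ℝ) * κ ^ (2 * m' - 2 * p) * N m' else 0) +
        ρ⁻¹ ^ (2 * p) * (Real.exp 1 * normV (SrcLabel V M (d * k - 1)) κ ρ N) *
          (Real.exp 1 * α * normV (SrcLabel V M (d * k - 1)) κ ρ N / κ ^ 2) / (1 - Real.exp 1 * α * normV (SrcLabel V M (d * k - 1)) κ ρ N / κ ^ 2)) /
        (1 + klScale klE0 jw * ((r : ℝ) + 1)) :=
  sum_far_norm_kernel_le_of_wt_profile hβ.le jw _ q i y r (truncStepSource_wt_profile_le hβ U μ K d k jw hZ hκ hGB N hN0 hN hα hrow hcol hρ hθ hp q y)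

omit [NeZero M] in
/-- **The raw row of the truncated doubled input itself** (the shape of the assembly's `hNI` for `k = 1`, any degree `m`): `≤ ε·klLipInputMeasDT V … d k j_w m` (`0 ≤ β`). -/
theorem truncInput_raw_row_le {β : ℝ} (hβ : 0 ≤ β) (U μ : ℝ) (K : TrigPolyC4v) (d k jw : ℕ) {m : ℕ} (q : Fin m) (y : SrcLabel V M (d * k - 1)) :
    ∑ Y ∈ univ.filter (fun Y : Fin m → SrcLabel V M (d * k - 1) => Y q = y), ‖kernel ℂ (klLipInputDT V M β U μ K d k) m Y‖ ≤
      imagTimeWeight β M * klLipInputMeasDT V M β U μ K d k jw m :=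
  sum_norm_kernel_le_of_wt_profile β jw _ q y (sum_wt_norm_kernel_klLipInputDT_le hβ U μ K d k jw q y)

omit [NeZero M] in
/-- **The far row of the truncated doubled input itself** (the shape of the assembly's `hNIfar` for `k = 1`, any degree `m`, depth `r`):
`≤ ε·klLipInputMeasDT V … d k j_w m / (1 + Λ_{j_w}(r+1))` (`0 ≤ β`). -/
theorem truncInput_far_row_le {β : ℝ} (hβ : 0 ≤ β) (U μ : ℝ) (K : TrigPolyC4v) (d k jw : ℕ) {m : ℕ} (q : Fin m) (y : SrcLabel V M (d * k - 1)) (i : Fin m) (r : ℕ) :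
    ∑ Y ∈ univ.filter (fun Y : Fin m → SrcLabel V M (d * k - 1) => Y q = y ∧ r < Torus.tnorm ((Y q).1.1.2 - (Y i).1.1.2)),
        ‖kernel ℂ (klLipInputDT V M β U μ K d k) m Y‖ ≤
      imagTimeWeight β M * klLipInputMeasDT V M β U μ K d k jw m / (1 + klScale klE0 jw * ((r : ℝ) + 1)) :=
  sum_far_norm_kernel_le_of_wt_profile hβ jw _ q i y r (sum_wt_norm_kernel_klLipInputDT_le hβ U μ K d k jw q y)

end StepSource

/-! ## §3 The assembly's pair `(hNs, hNfar)` from majorant arrays -/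

section Rows

variable {L M : ℕ} [NeZero L] [NeZero M]

/-- **THE STEP-SOURCE ROWS `hNs` / `hNfar` OF ✓ `klLipBornDiffSupDT_le_law_of_rows_base1_boot`, VERBATIM, FROM MAJORANTS** (coarse volume `L`, frame `K`, blocks `1 ≤ k < K_b`,
degrees `1 ≤ p ≤ D`, depth `r`, rate `j_w`).  Data per block: the token `Z^K_{L,Λ_{dk}} ≠ 0`, the Gram constant `κ_k` and the `klScaleWt_{j_w}`-weighted rows / columns `≤ α_k` of
`klLipCov L … d k` (sector statements), a majorant `N k m' ≥ ε·klLipInputMeasDT L … d k j_w (2m')` (N4⁺), `ρ_k > 0` with `θ_k < 1`; and arrays `Ns, Nfar` dominating the §2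
bound resp. the §2 bound `/ (1 + Λ_{j_w}(r+1))`.  Conclusion: the two rows, in the assembly's binder shape. -/
theorem truncStepSources_rows_of_majorants {β : ℝ} (hβ : 0 < β) (U μ : ℝ) (K : TrigPolyC4v) (d jw Kb D r : ℕ)
    (hZc : ∀ k, 1 ≤ k → k < Kb → hubbardEffPartitionFnCT L M β U μ 0 K (klScale klE0 (d * k)) ≠ 0)
    (κc αc ρc : ℕ → ℝ) (hκc : ∀ k, 1 ≤ k → k < Kb → 0 < κc k) (hαc : ∀ k, 1 ≤ k → k < Kb → 0 < αc k) (hρc : ∀ k, 1 ≤ k → k < Kb → 0 < ρc k)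
    (hGBc : ∀ k, 1 ≤ k → k < Kb → IsGramBoundedR (klLipCov L M β μ K d k) (κc k))
    (hrowc : ∀ k, 1 ≤ k → k < Kb → ∀ X, ∑ Y, ‖klLipCov L M β μ K d k X Y‖ *
      klScaleWt L M β jw {latticeLegPos (2 * (2 * M)) X, latticeLegPos (2 * (2 * M)) Y} ≤ αc k)
    (hcolc : ∀ k, 1 ≤ k → k < Kb → ∀ Y, ∑ X, ‖klLipCov L M β μ K d k X Y‖ *
      klScaleWt L M β jw {latticeLegPos (2 * (2 * M)) X, latticeLegPos (2 * (2 * M)) Y} ≤ αc k)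
    (N : ℕ → ℕ → ℝ) (hN0 : ∀ k m', 0 ≤ N k m')
    (hN : ∀ k, 1 ≤ k → k < Kb → ∀ m', imagTimeWeight β M * klLipInputMeasDT L M β U μ K d k jw (2 * m') ≤ N k m')
    (hθc : ∀ k, 1 ≤ k → k < Kb → Real.exp 1 * αc k * normV (SrcLabel L M (d * k - 1)) (κc k) (ρc k) (N k) / κc k ^ 2 < 1)
    (Ns Nfar : ℕ → ℕ → ℝ)
    (hNsB : ∀ k, 1 ≤ k → k < Kb → ∀ p, 1 ≤ p → p ≤ D →
      (∑ m' ∈ range (Fintype.card (SrcLabel L M (d * k - 1)) / 2 + 1),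
          if p < m' then ((2 * m').choose (2 * p) : ℝ) * κc k ^ (2 * m' - 2 * p) * N k m' else 0) +
        (ρc k)⁻¹ ^ (2 * p) * (Real.exp 1 * normV (SrcLabel L M (d * k - 1)) (κc k) (ρc k) (N k)) *
          (Real.exp 1 * αc k * normV (SrcLabel L M (d * k - 1)) (κc k) (ρc k) (N k) / κc k ^ 2) /
            (1 - Real.exp 1 * αc k * normV (SrcLabel L M (d * k - 1)) (κc k) (ρc k) (N k) / κc k ^ 2) ≤ Ns k p)
    (hNfarB : ∀ k, 1 ≤ k → k < Kb → ∀ p, 1 ≤ p → p ≤ D →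
      ((∑ m' ∈ range (Fintype.card (SrcLabel L M (d * k - 1)) / 2 + 1),
          if p < m' then ((2 * m').choose (2 * p) : ℝ) * κc k ^ (2 * m' - 2 * p) * N k m' else 0) +
        (ρc k)⁻¹ ^ (2 * p) * (Real.exp 1 * normV (SrcLabel L M (d * k - 1)) (κc k) (ρc k) (N k)) *
          (Real.exp 1 * αc k * normV (SrcLabel L M (d * k - 1)) (κc k) (ρc k) (N k) / κc k ^ 2) /
            (1 - Real.exp 1 * αc k * normV (SrcLabel L M (d * k - 1)) (κc k) (ρc k) (N k) / κc k ^ 2)) /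
        (1 + klScale klE0 jw * ((r : ℝ) + 1)) ≤ Nfar k p) :
    (∀ k, 1 ≤ k → k < Kb → ∀ p, 1 ≤ p → p ≤ D → ∀ (q : Fin ((2 * p - 1) + 1)) y,
      ∑ Y ∈ univ.filter (fun Y : Fin ((2 * p - 1) + 1) → (SrcLabel L M (d * k - 1)) => Y q = y),
        ‖kernel ℂ (effAction ℂ (klLipCovD L M β μ K d k) (klLipInputDT L M β U μ K d k) - klLipInputDT L M β U μ K d k) ((2 * p - 1) + 1) Y‖ ≤ Ns k p) ∧
    (∀ k, 1 ≤ k → k < Kb → ∀ p, 1 ≤ p → p ≤ D → ∀ (q : Fin ((2 * p - 1) + 1)) y (i : Fin ((2 * p - 1) + 1)),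
      ∑ Y ∈ univ.filter (fun Y : Fin ((2 * p - 1) + 1) → (SrcLabel L M (d * k - 1)) => Y q = y ∧ r < Torus.tnorm ((Y q).1.1.2 - (Y i).1.1.2)),
        ‖kernel ℂ (effAction ℂ (klLipCovD L M β μ K d k) (klLipInputDT L M β U μ K d k) - klLipInputDT L M β U μ K d k) ((2 * p - 1) + 1) Y‖ ≤ Nfar k p) :=
  ⟨fun k hk1 hkK p hp hpD q y =>
      (truncStepSource_raw_row_le hβ U μ K d k jw (hZc k hk1 hkK) (hκc k hk1 hkK) (hGBc k hk1 hkK) (N k) (hN0 k) (hN k hk1 hkK) (hαc k hk1 hkK)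
        (hrowc k hk1 hkK) (hcolc k hk1 hkK) (hρc k hk1 hkK) (hθc k hk1 hkK) hp q y).trans (hNsB k hk1 hkK p hp hpD),
    fun k hk1 hkK p hp hpD q y i =>
      (truncStepSource_far_row_le hβ U μ K d k jw (hZc k hk1 hkK) (hκc k hk1 hkK) (hGBc k hk1 hkK) (N k) (hN0 k) (hN k hk1 hkK) (hαc k hk1 hkK)
        (hrowc k hk1 hkK) (hcolc k hk1 hkK) (hρc k hk1 hkK) (hθc k hk1 hkK) hp q y i r).trans (hNfarB k hk1 hkK p hp hpD)⟩

end Rows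

end Summit.HubbardSuperconductivity.HubbardSuperconductivity.Theorems.TwoVolumeLip

end
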